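import Literature.Probability.Percolation.SlabRSWProp39b
import Literature.Probability.Percolation.SlabCriticalityInputs
import HarnessLib

/-!
# Newman–Tassion–Wu 2017, §3.5 — Lemma 3.15: the event `𝒜` of the RSW theorem has probability `≥ c₄`

Topic: `Literature/Probability/Percolation`. Lemma 3.15 of NTW (arXiv:1512.09107 p. 16), the first
step of the proof of the RSW Theorem 3.14 (positive-probability version): under the hypothesis
(3.38) `inf_m f_p(m,2m) ≥ c₀ > 0`, the event
`𝒜 = {L(S) ⟷^S X} ∩ {B(R) ⟷^R Y}` — `S = [0,7n] × [0,8n-1]`, `X = {7n} × [0,4n-1]` (the lower half of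
the right side of `S`), `R = [-7n,7n] × [0,13n-1]`, `Y = {7n} × [5n,13n-1]` (the upper part of the
right side of `R`) — has probability at least a constant `c₄ = c₄(c₀, k, p, ρ) > 0`, for every
`n ≥ ρ + 8`.  (We use half-open versions of NTW's `X = {7n}×[0,4n]`, `Y = {7n}×[5n,13n]` so that
`X = Z_0 ∪ ⋯ ∪ Z_3` and `Y = Z_5 ∪ ⋯ ∪ Z_12` EXACTLY, `Z_m = {7n} × [mn,(m+1)n-1]`, as Case 1 of the
proof of Thm. 3.14 requires — `SlabRSWLadder.lean`; accordingly `S` and `R` lose their top row.)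
Everything is in the LINEAR regime of GL0 (`h₀(x) = x/(1+λ^s)`), which is all the lemma uses.

Ingredients (all in the tree): Prop. 3.9 (2) (`prop39_item2_step`, p2 GEN 39), the half-side
square-root trick (as in `real_halfBottom_top_ge`), GL0 for a left-right versus a bottom-top
crossing (`glueLinear_rect_left`), Harris–FKG.

* `g_pos`, `g_le`, `g_mono` — the function `g(x) = 1 - (1-x)^{1/3}` of Prop. 3.9 (2);
* (Prop. 3.9 (2) in the `f`-form `g(f(n, n+m+m')) ≤ f(n, n+m)` is `prop39_item2_step'` of `SlabRSWProp39b.lean`);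
* `real_left_sideSeg_ge` — `P[L(S) ⟷^S Σ] ≥ 1 - √(1 - P[L(S) ⟷^S R(S)])` for a segment `Σ` of the
  right side which together with its mirror image covers the side;
* `slabConn_bottom_or_inside` — a path inside `K = [a,b] × [c',d]` from the left side to a set `Y`
  above the row `c` (`c' ≤ c`) either meets the row `c` (then `B(R) ⟷^R Y` in `R = [a,b] × [c,d]`)
  or stays inside `R` (then `L(R) ⟷^R Y`);
* **`lemma315`** — NTW Lemma 3.15 with an explicit constant:
  `∃ c₄ > 0, ∀ n ≥ ρ+8, (∀ m ≥ 1, c₀ ≤ f_p(m,2m)) → c₄ ≤ P_p[𝒜_n]`.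

## Sources

* C. M. Newman, V. Tassion, W. Wu, *Critical percolation and the minimal spanning tree in slabs*,
  Comm. Pure Appl. Math. 70 (2017) 2084–2120, arXiv:1512.09107: §3.5, Lemma 3.15 and its proof
  ((3.7), (3.12), (3.31)–(3.32)); Prop. 3.9 (2); Thm. 3.6 with Remark 3 [NewmanTassionWu2017].
-/

noncomputable section

namespace Literature.Probability.Percolation

open MeasureTheory LatticeModels SimpleGraph

namespace NTW17

variable {k : ℕ}

/-! ## §1 The function `g(x) = 1 - (1 - x)^{1/3}` -/

/-- `g(x) = 1 - (1-x)^{1/3} > 0` for `0 < x ≤ 1`. [cite: NewmanTassionWu2017, §3.3 (Proposition 3.9 (2))] -/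
theorem g_pos {x : ℝ} (hx0 : 0 < x) (hx1 : x ≤ 1) : 0 < 1 - (1 - x) ^ ((3 : ℝ)⁻¹) := by
  have : (1 - x) ^ ((3 : ℝ)⁻¹) < 1 := Real.rpow_lt_one (by linarith) (by linarith) (by norm_num)
  linarith

/-- `g(x) ≤ 1` for `x ≤ 1`. [cite: NewmanTassionWu2017, §3.3 (Proposition 3.9 (2))] -/
theorem g_le {x : ℝ} (hx1 : x ≤ 1) : 1 - (1 - x) ^ ((3 : ℝ)⁻¹) ≤ 1 := by
  have : 0 ≤ (1 - x) ^ ((3 : ℝ)⁻¹) := Real.rpow_nonneg (by linarith) _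
  linarith

/-- `g` is increasing on `(-∞, 1]`. [cite: NewmanTassionWu2017, §3.3 (Proposition 3.9 (2))] -/
theorem g_mono {x y : ℝ} (hxy : x ≤ y) (hy1 : y ≤ 1) :
    1 - (1 - x) ^ ((3 : ℝ)⁻¹) ≤ 1 - (1 - y) ^ ((3 : ℝ)⁻¹) := by
  have : (1 - y) ^ ((3 : ℝ)⁻¹) ≤ (1 - x) ^ ((3 : ℝ)⁻¹) :=
    Real.rpow_le_rpow (by linarith) (by linarith) (by norm_num)
  linarith

/-! ## §2 Half of the right side, from the left side (square-root trick) -/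

/-- Reflected rectangles (horizontal axis). [cite: NewmanTassionWu2017, §3.3 ("invariance under reflection")] -/
theorem image_planarFlip_boxR (a b c d : ℤ) : planarFlip (c + d) '' boxR a b c d = boxR a b c d := by
  ext w
  rw [Set.mem_image_equiv]
  simp only [planarFlip_symm, planarFlip_apply, mem_boxR_iff]
  omega

/-- Reflected vertical lines (horizontal axis). [cite: NewmanTassionWu2017, §3.3 ("invariance under reflection")] -/
theorem image_planarFlip_col (t a : ℤ) : planarFlip t '' {z : ℤ × ℤ | z.1 = a} = {z | z.1 = a} := by
  ext w
  rw [Set.mem_image_equiv]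
  simp only [planarFlip_symm, planarFlip_apply, Set.mem_setOf_eq]

/-- **The half-side square-root trick, left side to a segment of the right side**: in
`S = [a,b] × [c,d]`, if the segment `Σ = {b} × [s,t]` and its mirror image `{b} × [c+d-t, c+d-s]`
cover the right side, then `1 - √(1 - P_p[L(S) ⟷^S R(S)]) ≤ P_p[L(S) ⟷^S Σ]`.
[cite: NewmanTassionWu2017, §3.5 (proof of Lemma 3.15: "using a symmetry and the union bound"; (3.1) square-root trick)] -/
theorem real_left_sideSeg_ge {a b c d s t : ℤ}
    (hcover : ∀ y : ℤ, c ≤ y → y ≤ d → (s ≤ y ∧ y ≤ t) ∨ (c + d - t ≤ y ∧ y ≤ c + d - s))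
    (p : unitInterval) :
    1 - Real.sqrt (1 - (bondPercolation (slabGraph 3 k) p).real
        (slabConn k (boxR a b c d) {z | z.1 = a} {z | z.1 = b})) ≤
      (bondPercolation (slabGraph 3 k) p).real (slabConn k (boxR a b c d) {z | z.1 = a} (sideSeg b s t)) := by
  classical
  set P := bondPercolation (slabGraph 3 k) p with hP
  set E₁ := slabConn k (boxR a b c d) {z : ℤ × ℤ | z.1 = a} (sideSeg b s t) with hE₁
  set E₂ := slabConn k (boxR a b c d) {z : ℤ × ℤ | z.1 = a} (sideSeg b (c + d - t) (c + d - s)) with hE₂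
  let A : Bool → Set (BondConfig (slab 3 k)) := fun i => cond i E₁ E₂
  have hAup : ∀ i, IsUpperSet (A i) := by
    intro i; cases i <;> exact isUpperSet_openCrossing _ _ _
  have hAm : ∀ i, MeasurableSet (A i) := by
    intro i; cases i <;> exact measurableSet_slabConn_boxR _ _ _ _ _ _
  -- equal probabilities by the reflection `y ↦ c + d - y`
  have heq : P.real E₂ = P.real E₁ := by
    have h := real_slabConn_image k (planarFlip (c + d)) (planarAdj_planarFlip (c + d)) p
      (boxR a b c d) {z : ℤ × ℤ | z.1 = a} (sideSeg b s t)
    rw [image_planarFlip_boxR, image_planarFlip_col, image_planarFlip_sideSeg] at h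
    rw [hE₂, hE₁, hP]
    exact h
  have hAeq : ∀ i, P.real (A i) = P.real E₁ := by
    intro i; cases i
    · exact heq
    · rfl
  -- the union covers the left-right crossing
  have hcov : slabConn k (boxR a b c d) {z | z.1 = a} {z | z.1 = b} ⊆ ⋃ i, A i := by
    intro ω hω
    obtain ⟨l, hl⟩ := (mem_slabConn_iff_exists_isOSAP ω _ _ _).1 hω
    have hy := hl.last_mem hl.ne_nil
    have hyS := hl.subset _ (List.getLast_mem hl.ne_nil)
    rw [mem_slabLift_iff, Set.mem_setOf_eq] at hy
    rw [mem_slabLift_iff, mem_boxR_iff] at hyS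
    rcases hcover _ hyS.2.2.1 hyS.2.2.2 with h1 | h2
    · refine Set.mem_iUnion.2 ⟨true, ?_⟩
      exact (mem_slabConn_iff_exists_isOSAP ω _ _ _).2 ⟨l, ⟨hl.nodup, hl.chain, hl.subset, hl.ne_nil,
        hl.head_mem, fun h => by rw [mem_slabLift_iff]; exact ⟨hy, h1⟩⟩⟩
    · refine Set.mem_iUnion.2 ⟨false, ?_⟩
      exact (mem_slabConn_iff_exists_isOSAP ω _ _ _).2 ⟨l, ⟨hl.nodup, hl.chain, hl.subset, hl.ne_nil,
        hl.head_mem, fun h => by rw [mem_slabLift_iff]; exact ⟨hy, h2⟩⟩⟩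
  obtain ⟨i, hi⟩ := sqrt_trick_holds (slabGraph 3 k) p A hAup hAm
  rw [hAeq i] at hi
  refine le_trans ?_ hi
  have hcard : ((Fintype.card Bool : ℝ))⁻¹ = 1 / 2 := by norm_num
  rw [hcard, ← Real.sqrt_eq_rpow]
  have hmono : P.real (slabConn k (boxR a b c d) {z | z.1 = a} {z | z.1 = b}) ≤ P.real (⋃ i, A i) :=
    measureReal_mono hcov
  have h1 : P.real (⋃ i, A i) ≤ 1 := measureReal_le_one
  gcongr

/-! ## §3 A crossing of the box `[a,b] × [c',d]` meets the row `c` of `R` or stays inside `R` -/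

/-- **Dichotomy** (proof of Lemma 3.15: "either it touches the bottom side of `R`, or it remains
inside `R`"): for a target `Y` strictly above the row `c`, an `ω`-open path inside
`K = [a,b] × [c',d]` from the left side to `Y` either contains — after its last visit of the rows
`≤ c` — an open path inside `R = [a,b] × [c,d]` from the row `c` to `Y`, or lies inside `R` (lattice
configurations). [cite: NewmanTassionWu2017, §3.5 (proof of Lemma 3.15, (3.12))] -/
theorem slabConn_bottom_or_inside {a b c c' d : ℤ} {Y : Set (ℤ × ℤ)}
    (hY : ∀ z ∈ Y, c < z.2) {ω : BondConfig (slab 3 k)} (hω : ω ⊆ (slabGraph 3 k).edgeSet)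
    (h : ω ∈ slabConn k (boxR a b c' d) {z | z.1 = a} Y) :
    ω ∈ slabConn k (boxR a b c d) {z | z.2 = c} Y ∨ ω ∈ slabConn k (boxR a b c d) {z | z.1 = a} Y := by
  obtain ⟨l, hl⟩ := (mem_slabConn_iff_exists_isOSAP ω _ _ _).1 h
  have hbox : ∀ v ∈ l, a ≤ (planar k v).1 ∧ (planar k v).1 ≤ b ∧ c' ≤ (planar k v).2 ∧ (planar k v).2 ≤ d := by
    intro v hv; have := hl.subset v hv; rwa [mem_slabLift_iff, mem_boxR_iff] at this
  have hch := isChain_adj_of_isChain_open hω hl.chain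
  have hlastY : planar k (l.getLast hl.ne_nil) ∈ Y := by
    have := hl.last_mem hl.ne_nil; rwa [mem_slabLift_iff] at this
  by_cases hlow : ∃ v ∈ l, (planar k v).2 ≤ c
  · left
    obtain ⟨q₁, u, q₂, hleq, hu, hq₂⟩ := exists_last_split (p := fun w => (planar k w).2 ≤ c) l hlow
    simp only [not_le] at hq₂
    -- `u` is not the last vertex (which lies in `Y`, above the row `c`), so `q₂ ≠ []`
    have hq : q₂ ≠ [] := by
      intro hq; subst hq
      have hlast : l.getLast hl.ne_nil = u := by
        rw [List.getLast_congr _ (by simp) hleq]; simp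
      have := hY _ hlastY
      rw [hlast] at this
      exact absurd hu (not_le.2 this)
    -- `u` has height exactly `c`
    have hu2 : (planar k u).2 = c := by
      have hq₁u : q₁ ++ [u] ≠ [] := by simp
      have heq3 : l = (q₁ ++ [u]) ++ q₂ := by rw [hleq]; simp
      have hch' := hch; rw [heq3] at hch'
      have h1 := planar_mem_sqBox_one_of_adj (hch'.rel_getLast_head_of_append hq₁u hq)
      rw [List.getLast_append_of_ne_nil _ (by simp), List.getLast_singleton, mem_sqBox_iff'] at h1
      push_cast at h1
      have h2 := hq₂ _ (List.head_mem hq)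
      omega
    have hseg : IsOSAP k ω (slabLift k (boxR a b c d)) (slabLift k {z | z.2 = c}) (slabLift k Y) (u :: q₂) := by
      refine ⟨?_, ?_, ?_, List.cons_ne_nil u q₂, ?_, ?_⟩
      · have := hl.nodup; rw [hleq] at this
        exact this.sublist (by simp)
      · have := hl.chain; rw [hleq] at this
        exact this.right_of_append
      · intro x hx
        rw [mem_slabLift_iff, mem_boxR_iff]
        have hxl : x ∈ l := by rw [hleq]; simp only [List.mem_append, List.mem_cons] at hx ⊢; tauto
        obtain ⟨h1, h2, -, h4⟩ := hbox x hxl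
        rcases List.mem_cons.1 hx with rfl | hx
        · exact ⟨h1, h2, hu2.ge, h4⟩
        · exact ⟨h1, h2, (hq₂ x hx).le, h4⟩
      · intro _; simpa using hu2
      · intro hne
        rw [mem_slabLift_iff]
        have : (u :: q₂).getLast hne = l.getLast hl.ne_nil := by
          rw [List.getLast_congr _ (by simp) hleq]; simp
        rw [this]; exact hlastY
    exact (mem_slabConn_iff_exists_isOSAP ω _ _ _).2 ⟨_, hseg⟩
  · right
    push Not at hlow
    exact (mem_slabConn_iff_exists_isOSAP ω _ _ _).2 ⟨l, ⟨hl.nodup, hl.chain,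
      fun v hv => by
        rw [mem_slabLift_iff, mem_boxR_iff]
        obtain ⟨h1, h2, -, h4⟩ := hbox v hv
        exact ⟨h1, h2, (hlow v hv).le, h4⟩,
      hl.ne_nil, hl.head_mem, hl.last_mem⟩⟩

/-! ## §4 Lemma 3.15 -/

/-- **NTW 2017, LEMMA 3.15** (explicit-constant form).  Slab `S_k`, `k ≥ 1`, `ρ ≥ 2`, `0 < p < 1`,
`0 < c₀ ≤ 1`.  There is `c₄ = c₄(c₀,k,p,ρ) > 0` such that for every `n ≥ ρ + 8`: if
`f_p(m, 2m) ≥ c₀` for all `m ≥ 1` (hypothesis (3.38)), then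
`P_p[{L(S) ⟷^S X} ∩ {B(R) ⟷^R Y}] ≥ c₄`, where `S = [0,7n] × [0,8n-1]`, `X = {7n} × [0,4n-1]`,
`R = [-7n,7n] × [0,13n-1]`, `Y = {7n} × [5n,13n-1]`.  Proof as printed: (3.7) from Prop. 3.9 (2)
(three steps down from `f(7n,15n-8) ≥ f(7n,14n) ≥ c₀`) and the half-side square-root trick; (3.12)
from `f(14n,16n-2)`, `f(13n-1,14n)` (Prop. 3.9 (2)), the half-side trick in
`K = [-7n,7n] × [-3n+1,13n-1]`, the dichotomy "the path touches `B(R)` or stays inside `R`", and in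
the second case GL0 in `R` (`glueLinear_rect_left`: `Y ⟷ L(R)` versus `B(R) ⟷ T(R)`); finally
Harris–FKG.  Explicitly `c₄ = s₁² g⁴(c₀) / (2(1+λ^{s'}))` with `g(x) = 1-(1-x)^{1/3}`,
`s₁ = 1 - √(1 - g³(c₀))`, `λ = 2/min(p,1-p)`, `s' = 3(5k+4)(12ρ+9)²`.
[cite: NewmanTassionWu2017, Lemma 3.15] -/
theorem lemma315 (hk : 1 ≤ k) {ρ : ℕ} (hρ : 2 ≤ ρ) (p : unitInterval) (hp0 : 0 < (p : ℝ))
    (hp1 : (p : ℝ) < 1) {c₀ : ℝ} (hc₀ : 0 < c₀) (hc₁ : c₀ ≤ 1) :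
    ∃ c₄ : ℝ, 0 < c₄ ∧ ∀ n : ℕ, ρ + 8 ≤ n →
      (∀ m : ℕ, 1 ≤ m → c₀ ≤ (bondPercolation (slabGraph 3 k) p).real
          (slabConn k (boxR 0 m 0 (2 * m)) {z | z.1 = 0} {z | z.1 = m})) →
      c₄ ≤ (bondPercolation (slabGraph 3 k) p).real
        (slabConn k (boxR 0 (7 * n) 0 (8 * n - 1)) {z | z.1 = 0} (sideSeg (7 * n) 0 (4 * n - 1)) ∩
          slabConn k (boxR (-(7 * n)) (7 * n) 0 (13 * n - 1)) {z | z.2 = 0}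
            (sideSeg (7 * n) (5 * n) (13 * n - 1))) := by
  classical
  set P := bondPercolation (slabGraph 3 k) p with hP
  -- the function `g` and the constants
  let g : ℝ → ℝ := fun x => 1 - (1 - x) ^ ((3 : ℝ)⁻¹)
  have gmono : ∀ {x y : ℝ}, x ≤ y → y ≤ 1 → g x ≤ g y := fun hxy hy => g_mono hxy hy
  have gpos : ∀ {x : ℝ}, 0 < x → x ≤ 1 → 0 < g x := fun hx0 hx1 => g_pos hx0 hx1
  have gle : ∀ {x : ℝ}, x ≤ 1 → g x ≤ 1 := fun hx1 => g_le hx1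
  have hg1 : 0 < g c₀ := gpos hc₀ hc₁
  have hg1' : g c₀ ≤ 1 := gle hc₁
  have hg2 : 0 < g (g c₀) := gpos hg1 hg1'
  have hg2' : g (g c₀) ≤ 1 := gle hg1'
  have hg3 : 0 < g (g (g c₀)) := gpos hg2 hg2'
  have hg3' : g (g (g c₀)) ≤ 1 := gle hg2'
  have hg4 : 0 < g (g (g (g c₀))) := gpos hg3 hg3'
  have hg4' : g (g (g (g c₀))) ≤ 1 := gle hg3'
  set c₂ : ℝ := g (g (g (g c₀))) with hc₂
  set s₁ : ℝ := 1 - Real.sqrt (1 - g (g (g c₀))) with hs₁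
  have hs₁pos : 0 < s₁ := by
    have h1 : Real.sqrt (1 - g (g (g c₀))) < Real.sqrt 1 := Real.sqrt_lt_sqrt (by linarith) (by linarith)
    rw [Real.sqrt_one] at h1
    rw [hs₁]; linarith
  have hs₁le : s₁ ≤ 1 := by rw [hs₁]; linarith [Real.sqrt_nonneg (1 - g (g (g c₀)))]
  clear_value c₂ s₁
  set Λ : ℝ := 1 + (2 / min (p : ℝ) (1 - p)) ^ (3 * ((5 * k + 4) * (2 * (6 * ρ + 4) + 1) ^ 2)) with hΛ
  have hΛ1 : 1 ≤ Λ := le_add_of_nonneg_right (by positivity)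
  have hΛpos : 0 < Λ := lt_of_lt_of_le one_pos hΛ1
  clear_value Λ
  refine ⟨s₁ * (s₁ * c₂ / (2 * Λ)), by positivity, fun n hn hyp => ?_⟩
  have hn8 : 8 ≤ n := by omega
  have hnρ : ρ + 2 ≤ n := by omega
  have hn0 : (0 : ℤ) ≤ n := by positivity
  have hn1 : (8 : ℤ) ≤ n := by exact_mod_cast hn8
  -- notation for `f`
  have f_le_one : ∀ (w h : ℤ), P.real (slabConn k (boxR 0 w 0 h) {z : ℤ × ℤ | z.1 = 0} {z | z.1 = w}) ≤ 1 :=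
    fun _ _ => measureReal_le_one
  have hypZ : ∀ m : ℕ, 1 ≤ m → c₀ ≤ P.real (slabConn k (boxR 0 (m : ℤ) 0 (2 * (m : ℤ))) {z : ℤ × ℤ | z.1 = 0} {z | z.1 = (m : ℤ)}) :=
    fun m hm => hyp m hm
  ---------------------------------------------------------------- (3.7): `f(7n, 8n-1) ≥ g³(c₀)`
  have hA1 : c₀ ≤ P.real (slabConn k (boxR 0 (7 * n) 0 (15 * n - 8)) {z : ℤ × ℤ | z.1 = 0} {z | z.1 = 7 * n}) := by
    have h1 := hypZ (7 * n) (by omega); push_cast at h1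
    exact h1.trans (real_lr_le_taller (k := k) (a := 0) (b := 7 * n) (c := 0) (d := 2 * (7 * (n : ℤ)))
      (c' := 0) (d' := 15 * n - 8) le_rfl (by linarith) p)
  have hA2 : g c₀ ≤ P.real (slabConn k (boxR 0 (7 * n) 0 (11 * n - 4)) {z : ℤ × ℤ | z.1 = 0} {z | z.1 = 7 * n}) := by
    have h := prop39_item2_step' (k := k) (n := 7 * n) (m := 4 * n - 4) (m' := 4 * n - 4) (by linarith) le_rfl (by linarith) p
    rw [show (7 : ℤ) * n + (4 * n - 4) + (4 * n - 4) = 15 * n - 8 by ring,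
      show (7 : ℤ) * n + (4 * n - 4) = 11 * n - 4 by ring] at h
    exact (gmono hA1 (f_le_one _ _)).trans h
  have hA3 : g (g c₀) ≤ P.real (slabConn k (boxR 0 (7 * n) 0 (9 * n - 2)) {z : ℤ × ℤ | z.1 = 0} {z | z.1 = 7 * n}) := by
    have h := prop39_item2_step' (k := k) (n := 7 * n) (m := 2 * n - 2) (m' := 2 * n - 2) (by linarith) le_rfl (by linarith) p
    rw [show (7 : ℤ) * n + (2 * n - 2) + (2 * n - 2) = 11 * n - 4 by ring,
      show (7 : ℤ) * n + (2 * n - 2) = 9 * n - 2 by ring] at h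
    exact (gmono hA2 (f_le_one _ _)).trans h
  have hA4 : g (g (g c₀)) ≤ P.real (slabConn k (boxR 0 (7 * n) 0 (8 * n - 1)) {z : ℤ × ℤ | z.1 = 0} {z | z.1 = 7 * n}) := by
    have h := prop39_item2_step' (k := k) (n := 7 * n) (m := n - 1) (m' := n - 1) (by linarith) le_rfl (by linarith) p
    rw [show (7 : ℤ) * n + (n - 1) + (n - 1) = 9 * n - 2 by ring,
      show (7 : ℤ) * n + (n - 1) = 8 * n - 1 by ring] at h
    exact (gmono hA3 (f_le_one _ _)).trans h
  -- half of the right side of `S`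
  have hX : s₁ ≤ P.real (slabConn k (boxR 0 (7 * n) 0 (8 * n - 1)) {z : ℤ × ℤ | z.1 = 0} (sideSeg (7 * n) 0 (4 * n - 1))) := by
    have h := real_left_sideSeg_ge (k := k) (a := 0) (b := 7 * n) (c := 0) (d := 8 * n - 1) (s := 0) (t := 4 * n - 1)
      (fun y hy1 hy2 => by omega) p
    refine le_trans ?_ h
    rw [hs₁]
    have := Real.sqrt_le_sqrt (show 1 - P.real (slabConn k (boxR 0 (7 * n) 0 (8 * n - 1)) {z : ℤ × ℤ | z.1 = 0} {z | z.1 = 7 * n})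
      ≤ 1 - g (g (g c₀)) by linarith)
    linarith
  ---------------------------------------------------------------- (3.31): `f(14n, 16n-2) ≥ g³(c₀)`
  have hC1 : c₀ ≤ P.real (slabConn k (boxR 0 (14 * n) 0 (30 * n - 16)) {z : ℤ × ℤ | z.1 = 0} {z | z.1 = 14 * n}) := by
    have h1 := hypZ (14 * n) (by omega); push_cast at h1
    exact h1.trans (real_lr_le_taller (k := k) (a := 0) (b := 14 * n) (c := 0) (d := 2 * (14 * (n : ℤ)))
      (c' := 0) (d' := 30 * n - 16) le_rfl (by linarith) p)
  have hC2 : g c₀ ≤ P.real (slabConn k (boxR 0 (14 * n) 0 (22 * n - 8)) {z : ℤ × ℤ | z.1 = 0} {z | z.1 = 14 * n}) := by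
    have h := prop39_item2_step' (k := k) (n := 14 * n) (m := 8 * n - 8) (m' := 8 * n - 8) (by linarith) le_rfl (by linarith) p
    rw [show (14 : ℤ) * n + (8 * n - 8) + (8 * n - 8) = 30 * n - 16 by ring,
      show (14 : ℤ) * n + (8 * n - 8) = 22 * n - 8 by ring] at h
    exact (gmono hC1 (f_le_one _ _)).trans h
  have hC3 : g (g c₀) ≤ P.real (slabConn k (boxR 0 (14 * n) 0 (18 * n - 4)) {z : ℤ × ℤ | z.1 = 0} {z | z.1 = 14 * n}) := by
    have h := prop39_item2_step' (k := k) (n := 14 * n) (m := 4 * n - 4) (m' := 4 * n - 4) (by linarith) le_rfl (by linarith) p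
    rw [show (14 : ℤ) * n + (4 * n - 4) + (4 * n - 4) = 22 * n - 8 by ring,
      show (14 : ℤ) * n + (4 * n - 4) = 18 * n - 4 by ring] at h
    exact (gmono hC2 (f_le_one _ _)).trans h
  have hC4 : g (g (g c₀)) ≤ P.real (slabConn k (boxR 0 (14 * n) 0 (16 * n - 2)) {z : ℤ × ℤ | z.1 = 0} {z | z.1 = 14 * n}) := by
    have h := prop39_item2_step' (k := k) (n := 14 * n) (m := 2 * n - 2) (m' := 2 * n - 2) (by linarith) le_rfl (by linarith) p
    rw [show (14 : ℤ) * n + (2 * n - 2) + (2 * n - 2) = 18 * n - 4 by ring,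
      show (14 : ℤ) * n + (2 * n - 2) = 16 * n - 2 by ring] at h
    exact (gmono hC3 (f_le_one _ _)).trans h
  -- in `K = [-7n,7n] × [-3n+1, 13n-1]`: from the left side to `Y`
  have hK : s₁ ≤ P.real (slabConn k (boxR (-(7 * n)) (7 * n) (-(3 * n) + 1) (13 * n - 1)) {z : ℤ × ℤ | z.1 = -(7 * n)}
      (sideSeg (7 * n) (5 * n) (13 * n - 1))) := by
    have hsh := real_lr_shift (k := k) ((-(7 * (n : ℤ))), -(3 * (n : ℤ)) + 1) 0 (14 * n) 0 (16 * n - 2) p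
    dsimp only at hsh
    rw [show (0 : ℤ) + -(7 * (n : ℤ)) = -(7 * n) by ring, show (14 : ℤ) * n + -(7 * (n : ℤ)) = 7 * n by ring,
      show (0 : ℤ) + (-(3 * (n : ℤ)) + 1) = -(3 * n) + 1 by ring,
      show (16 : ℤ) * n - 2 + (-(3 * (n : ℤ)) + 1) = 13 * n - 1 by ring] at hsh
    have h := real_left_sideSeg_ge (k := k) (a := -(7 * n)) (b := 7 * n) (c := -(3 * n) + 1) (d := 13 * n - 1)
      (s := 5 * n) (t := 13 * n - 1) (fun y hy1 hy2 => by omega) p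
    rw [hsh] at h
    refine le_trans ?_ h
    rw [hs₁]
    have := Real.sqrt_le_sqrt (show 1 - P.real (slabConn k (boxR 0 (14 * n) 0 (16 * n - 2)) {z : ℤ × ℤ | z.1 = 0} {z | z.1 = 14 * n})
      ≤ 1 - g (g (g c₀)) by linarith)
    linarith
  -- the dichotomy: `B(R) ⟷^R Y` or `L(R) ⟷^R Y`
  set Eb := slabConn k (boxR (-(7 * n)) (7 * n) 0 (13 * n - 1)) {z : ℤ × ℤ | z.2 = 0} (sideSeg (7 * n) (5 * n) (13 * n - 1)) with hEb
  set El := slabConn k (boxR (-(7 * n)) (7 * n) 0 (13 * n - 1)) {z : ℤ × ℤ | z.1 = -(7 * n)} (sideSeg (7 * n) (5 * n) (13 * n - 1)) with hEl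
  have hEbm : MeasurableSet Eb := measurableSet_slabConn_boxR _ _ _ _ _ _
  have hElm : MeasurableSet El := measurableSet_slabConn_boxR _ _ _ _ _ _
  have hdich : s₁ ≤ P.real Eb + P.real El := by
    refine hK.trans ?_
    have hae : ∀ᵐ ω ∂P, ω ∈ slabConn k (boxR (-(7 * n)) (7 * n) (-(3 * n) + 1) (13 * n - 1)) {z : ℤ × ℤ | z.1 = -(7 * n)}
        (sideSeg (7 * n) (5 * n) (13 * n - 1)) → ω ∈ Eb ∪ El := by
      filter_upwards [ae_subset_edgeSet (slabGraph 3 k) p] with ω hω h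
      exact slabConn_bottom_or_inside (c := 0) (fun z hz => by rw [sideSeg, Set.mem_setOf_eq] at hz; omega) hω h
    have h1 : P.real (slabConn k (boxR (-(7 * n)) (7 * n) (-(3 * n) + 1) (13 * n - 1)) {z : ℤ × ℤ | z.1 = -(7 * n)}
        (sideSeg (7 * n) (5 * n) (13 * n - 1))) ≤ P.real (Eb ∪ El) := by
      simp only [measureReal_def]
      exact ENNReal.toReal_mono (measure_ne_top _ _) (measure_mono_ae hae)
    exact h1.trans (measureReal_union_le _ _)
  ---------------------------------------------------------------- (3.32): `f(13n-1, 14n) ≥ g⁴(c₀)`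
  have hD1 : c₀ ≤ P.real (slabConn k (boxR 0 (13 * n - 1) 0 (29 * n + 15)) {z : ℤ × ℤ | z.1 = 0} {z | z.1 = 13 * n - 1}) := by
    have h1 := hypZ (13 * n - 1) (by omega)
    have e : ((13 * n - 1 : ℕ) : ℤ) = 13 * n - 1 := by push_cast [show 1 ≤ 13 * n by omega]; ring
    rw [e] at h1
    exact h1.trans (real_lr_le_taller (k := k) (a := 0) (b := 13 * n - 1) (c := 0) (d := 2 * (13 * (n : ℤ) - 1))
      (c' := 0) (d' := 29 * n + 15) le_rfl (by linarith) p)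
  have hD2 : g c₀ ≤ P.real (slabConn k (boxR 0 (13 * n - 1) 0 (21 * n + 7)) {z : ℤ × ℤ | z.1 = 0} {z | z.1 = 13 * n - 1}) := by
    have h := prop39_item2_step' (k := k) (n := 13 * n - 1) (m := 8 * n + 8) (m' := 8 * n + 8) (by linarith) le_rfl (by linarith) p
    rw [show (13 : ℤ) * n - 1 + (8 * n + 8) + (8 * n + 8) = 29 * n + 15 by ring,
      show (13 : ℤ) * n - 1 + (8 * n + 8) = 21 * n + 7 by ring] at h
    exact (gmono hD1 (f_le_one _ _)).trans h
  have hD3 : g (g c₀) ≤ P.real (slabConn k (boxR 0 (13 * n - 1) 0 (17 * n + 3)) {z : ℤ × ℤ | z.1 = 0} {z | z.1 = 13 * n - 1}) := by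
    have h := prop39_item2_step' (k := k) (n := 13 * n - 1) (m := 4 * n + 4) (m' := 4 * n + 4) (by linarith) le_rfl (by linarith) p
    rw [show (13 : ℤ) * n - 1 + (4 * n + 4) + (4 * n + 4) = 21 * n + 7 by ring,
      show (13 : ℤ) * n - 1 + (4 * n + 4) = 17 * n + 3 by ring] at h
    exact (gmono hD2 (f_le_one _ _)).trans h
  have hD4 : g (g (g c₀)) ≤ P.real (slabConn k (boxR 0 (13 * n - 1) 0 (15 * n + 1)) {z : ℤ × ℤ | z.1 = 0} {z | z.1 = 13 * n - 1}) := by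
    have h := prop39_item2_step' (k := k) (n := 13 * n - 1) (m := 2 * n + 2) (m' := 2 * n + 2) (by linarith) le_rfl (by linarith) p
    rw [show (13 : ℤ) * n - 1 + (2 * n + 2) + (2 * n + 2) = 17 * n + 3 by ring,
      show (13 : ℤ) * n - 1 + (2 * n + 2) = 15 * n + 1 by ring] at h
    exact (gmono hD3 (f_le_one _ _)).trans h
  have hD5 : c₂ ≤ P.real (slabConn k (boxR 0 (13 * n - 1) 0 (14 * n)) {z : ℤ × ℤ | z.1 = 0} {z | z.1 = 13 * n - 1}) := by
    have h := prop39_item2_step' (k := k) (n := 13 * n - 1) (m := n + 1) (m' := n + 1) (by linarith) le_rfl (by linarith) p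
    rw [show (13 : ℤ) * n - 1 + (n + 1) + (n + 1) = 15 * n + 1 by ring,
      show (13 : ℤ) * n - 1 + (n + 1) = 14 * n by ring] at h
    rw [hc₂]
    exact (gmono hD4 (f_le_one _ _)).trans h
  -- `B(R) ⟷^R T(R)` has probability `f(13n-1, 14n)`
  have hTB : c₂ ≤ P.real (slabConn k (boxR (-(7 * n)) (7 * n) 0 (13 * n - 1)) {z : ℤ × ℤ | z.2 = 0} {z | z.2 = 13 * n - 1}) := by
    rw [real_bt_eq_lr]
    have hsh := real_lr_shift (k := k) ((0 : ℤ), -(7 * (n : ℤ))) 0 (13 * n - 1) 0 (14 * n) p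
    dsimp only at hsh
    rw [show (0 : ℤ) + -(7 * (n : ℤ)) = -(7 * n) by ring, show (14 : ℤ) * n + -(7 * (n : ℤ)) = 7 * n by ring] at hsh
    simp only [add_zero] at hsh
    rw [hsh]; exact hD5
  -- GL0 in `R`: `Y ⟷ L(R)` versus `B(R) ⟷ T(R)`
  have hGL := glueLinear_rect_left (k := k) (a := -(7 * n)) (b := 7 * n) (c := 0) (d := 13 * n - 1)
    (by linarith) (by linarith) (A := sideSeg (7 * n) (5 * n) (13 * n - 1))
    (C := {z : ℤ × ℤ | z ∈ boxR (-(7 * n)) (7 * n) 0 (13 * n - 1) ∧ z.2 = 0}) (Dd := {z : ℤ × ℤ | z.2 = 13 * n - 1})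
    (fun z hz => by rw [sideSeg, Set.mem_setOf_eq] at hz; rw [mem_boxR_iff]; exact ⟨by omega, hz.1⟩)
    (fun z hz => hz) (fun z hz => hz) hk hρ
    (fun a' ha' c' hc' hmem => by
      rw [sideSeg, Set.mem_setOf_eq] at ha'
      have hc'2 : c'.2 = 0 := hc'.2
      rw [mem_sqBox_iff'] at hmem
      have : (ρ : ℤ) + 2 ≤ n := by exact_mod_cast hnρ
      push_cast at hmem
      omega)
    p hp0 hp1
  rw [← hΛ] at hGL
  -- the three comparisons with the events of the proof
  have hL1 : P.real El ≤ P.real (slabConn k (boxR (-(7 * n)) (7 * n) 0 (13 * n - 1)) (sideSeg (7 * n) (5 * n) (13 * n - 1))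
      {z | z ∈ boxR (-(7 * n)) (7 * n) 0 (13 * n - 1) ∧ z.1 = -(7 * n)}) := by
    rw [hEl, _root_.Literature.Probability.Percolation.slabConn_comm k]
    exact measureReal_mono slabConn_subset_inter_target
  have hL2 : P.real (slabConn k (boxR (-(7 * n)) (7 * n) 0 (13 * n - 1)) {z : ℤ × ℤ | z.2 = 0} {z | z.2 = 13 * n - 1}) ≤
      P.real (slabConn k (boxR (-(7 * n)) (7 * n) 0 (13 * n - 1))
        {z : ℤ × ℤ | z ∈ boxR (-(7 * n)) (7 * n) 0 (13 * n - 1) ∧ z.2 = 0} {z | z.2 = 13 * n - 1}) :=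
    measureReal_mono slabConn_subset_inter_source
  have hL3 : P.real (slabConn k (boxR (-(7 * n)) (7 * n) 0 (13 * n - 1))
        {z : ℤ × ℤ | z ∈ boxR (-(7 * n)) (7 * n) 0 (13 * n - 1) ∧ z.2 = 0} (sideSeg (7 * n) (5 * n) (13 * n - 1))) ≤
      P.real Eb := measureReal_mono (slabConn_mono_sets subset_rfl (fun z hz => hz.2) subset_rfl)
  -- `P[B(R) ⟷ Y] ≥ s₁ c₂ / (2Λ)`
  have hEb_ge : s₁ * c₂ / (2 * Λ) ≤ P.real Eb := by
    have hv : P.real El * c₂ ≤ Λ * P.real Eb := by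
      calc P.real El * c₂ ≤ P.real (slabConn k (boxR (-(7 * n)) (7 * n) 0 (13 * n - 1)) (sideSeg (7 * n) (5 * n) (13 * n - 1))
              {z | z ∈ boxR (-(7 * n)) (7 * n) 0 (13 * n - 1) ∧ z.1 = -(7 * n)}) *
            P.real (slabConn k (boxR (-(7 * n)) (7 * n) 0 (13 * n - 1))
              {z : ℤ × ℤ | z ∈ boxR (-(7 * n)) (7 * n) 0 (13 * n - 1) ∧ z.2 = 0} {z | z.2 = 13 * n - 1}) :=
            mul_le_mul hL1 (hTB.trans hL2) hg4.le measureReal_nonneg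
        _ ≤ _ := hGL
        _ ≤ Λ * P.real Eb := mul_le_mul_of_nonneg_left hL3 hΛpos.le
    have hu1 : P.real Eb * c₂ ≤ Λ * P.real Eb := by
      calc P.real Eb * c₂ ≤ P.real Eb * 1 := mul_le_mul_of_nonneg_left hg4' measureReal_nonneg
        _ ≤ Λ * P.real Eb := by rw [mul_one]; exact le_mul_of_one_le_left measureReal_nonneg hΛ1
    have h2 : s₁ * c₂ ≤ 2 * Λ * P.real Eb := by
      calc s₁ * c₂ ≤ (P.real Eb + P.real El) * c₂ := mul_le_mul_of_nonneg_right hdich hg4.le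
        _ = P.real Eb * c₂ + P.real El * c₂ := by ring
        _ ≤ Λ * P.real Eb + Λ * P.real Eb := add_le_add hu1 hv
        _ = 2 * Λ * P.real Eb := by ring
    rw [div_le_iff₀ (by positivity)]
    linarith
  -- Harris–FKG
  have hH := harris_fkg_holds (slabGraph 3 k) p (isUpperSet_openCrossing _ _ _) (isUpperSet_openCrossing _ _ _)
    (measurableSet_slabConn_boxR (k := k) 0 (7 * n) 0 (8 * n - 1) {z : ℤ × ℤ | z.1 = 0} (sideSeg (7 * n) 0 (4 * n - 1)))
    hEbm
  refine le_trans ?_ hH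
  exact mul_le_mul hX hEb_ge (by positivity) measureReal_nonneg

end NTW17

end Literature.Probability.Percolation
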